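import Summits.QuantumFields.YangMills.Theorems.VirialFluxGapFixGaugeAction
import HarnessLib

/-!
# Splitting the tree-gauged ring space at the TWO ANCHORS — definitions
# (layer (B2) of the DIRECT Laplace road to ⟨stmt-QuantumFields-24204⟩ `VirialFluxGap.SharpTwistedLaplace`)

Problem-side definitions (free-hands work of width seat ym-line-sfw-p2-w3 g57, cell ym-idea-1; `--supports 24204`).  The tree-gauged ring space
`X_fix(L) = SU2^{off-tree} × (GaugeConfig 3 L SU2)^{2L−1} × SU2^{sites}` (✓`VirialFluxGapRingTreeGauge`, ✓`VirialFluxGapFixGaugeAction`) is split as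
«two anchor components × the rest», so that the chart identity of the anchor core (✓`AnchorSlice.haar_prod_restrict_image_anchorMap`) can be
tensored (✓`ChartTensor.restrict_image_tensorWindow_eq_map_withDensity`) with the conjugated exponential charts of the remaining components
(✓`ConjChart.map_pi_conjChart`).  The anchors are an off-tree link `e₀` of slice `0` (the wrapping link `((−1,−1,−1), k₀)`,
✓`not_treeEdge_wrap`) and a seam site `y₀` (the origin):
* `FixSpace L` — the tree-gauged ring space (an abbreviation of the product type used throughout the VirialFluxGap files);
* `FixRest L e₀ y₀` — the remaining components: off-tree links `≠ e₀`, the `2L−1` full slices, the seam sites `≠ y₀`;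
* `restMeasure L e₀ y₀` — their product Haar measure;
* `fixSplit L e₀ y₀ : FixSpace L ≃ᵐ (SU2 × SU2) × FixRest L e₀ y₀` — the measurable splitting `x ↦ ((x_seam(y₀), x_off(e₀)), rest)` with its
  explicit inverse (re-insertion of the two anchor values).
HONEST FRAMING: definitions only (no theorem, no `sorry`); nothing about ⟨24204⟩ is proved here; the Yang–Mills mass gap is NOT proved; no summit
is proved by a line.

## References
* G. E. Bredon, *Introduction to Compact Transformation Groups* (1972), Ch. II §§4–5. [Bredon1972]
* S. Helgason, *Groups and Geometric Analysis* (2000), Ch. I §1 Thm 1.14. [Helgason2000]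
-/

set_option autoImplicit false

noncomputable section

open MeasureTheory
open Literature.MathematicalPhysics.QuantumFieldTheory hiding SU2
open Summit.QuantumFields.YangMills.Theorems.FemtoTransferGap
open Summit.QuantumFields.YangMills.Theorems.FemtoTransferGap.TT

namespace Summit.QuantumFields.YangMills.Theorems.VirialFluxGap.FixSplit

variable (L : ℕ) [NeZero L]

/-- The tree-gauged ring space `X_fix(L) = SU2^{off-tree} × (GaugeConfig 3 L SU2)^{2L−1} × SU2^{sites}`. [cite: Bredon1972, Ch. II §4] -/
abbrev FixSpace : Type := (OffIdx L → SU2) × ((Fin (2 * L - 1) → GaugeConfig 3 L SU2) × (Site 3 L → SU2))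

/-- The components of `X_fix` other than the two anchors `e₀` (off-tree link of slice `0`) and `y₀` (seam site). [cite: Bredon1972, Ch. II §4] -/
abbrev FixRest (e₀ : OffIdx L) (y₀ : Site 3 L) : Type :=
  ({i : OffIdx L // ¬ i = e₀} → SU2) × ((Fin (2 * L - 1) → GaugeConfig 3 L SU2) × ({y : Site 3 L // ¬ y = y₀} → SU2))

/-- Product Haar measure on the remaining components. [cite: Helgason2000, Ch. I §1 Thm 1.14] -/
def restMeasure (e₀ : OffIdx L) (y₀ : Site 3 L) : Measure (FixRest L e₀ y₀) :=
  (Measure.pi fun _ : {i : OffIdx L // ¬ i = e₀} => haarProbability SU2).prod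
    ((Measure.pi fun _ : Fin (2 * L - 1) => configMeasure SU2 L).prod
      (Measure.pi fun _ : {y : Site 3 L // ¬ y = y₀} => haarProbability SU2))

/-- **THE SPLITTING AT THE TWO ANCHORS** `x ↦ ((x_seam(y₀), x_off(e₀)), rest)`, a measurable equivalence
`X_fix ≃ᵐ (SU2 × SU2) × FixRest` (first anchor = the seam site, second = the off-tree link, matching the order of
✓`AnchorSlice.anchorMap`). [cite: Bredon1972, Ch. II §4] -/
def fixSplit (e₀ : OffIdx L) (y₀ : Site 3 L) : FixSpace L ≃ᵐ (SU2 × SU2) × FixRest L e₀ y₀ where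
  toFun x := ((x.2.2 y₀, x.1 e₀), (fun i => x.1 i.1, (x.2.1, fun y => x.2.2 y.1)))
  invFun p := (fun i => if h : i = e₀ then p.1.2 else p.2.1 ⟨i, h⟩,
    (p.2.2.1, fun y => if h : y = y₀ then p.1.1 else p.2.2.2 ⟨y, h⟩))
  left_inv x := by
    refine Prod.ext ?_ (Prod.ext rfl ?_)
    · funext i
      by_cases h : i = e₀
      · simp only [h, dif_pos]
      · simp only [h, dif_neg, not_false_eq_true]
    · funext y
      by_cases h : y = y₀
      · simp only [h, dif_pos]
      · simp only [h, dif_neg, not_false_eq_true]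
  right_inv p := by
    obtain ⟨⟨c, n⟩, r₁, f, r₃⟩ := p
    refine Prod.ext (Prod.ext ?_ ?_) (Prod.ext ?_ (Prod.ext rfl ?_))
    · simp
    · simp
    · funext i; simp [i.2]
    · funext y; simp [y.2]
  measurable_toFun := by
    refine Measurable.prodMk (Measurable.prodMk ?_ ?_) (Measurable.prodMk ?_ (Measurable.prodMk ?_ ?_))
    · exact (measurable_pi_apply y₀).comp (measurable_snd.comp measurable_snd)
    · exact (measurable_pi_apply e₀).comp measurable_fst
    · exact measurable_pi_lambda _ fun i => (measurable_pi_apply i.1).comp measurable_fst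
    · exact measurable_fst.comp measurable_snd
    · exact measurable_pi_lambda _ fun y => (measurable_pi_apply y.1).comp (measurable_snd.comp measurable_snd)
  measurable_invFun := by
    refine Measurable.prodMk ?_ (Measurable.prodMk ?_ ?_)
    · refine measurable_pi_lambda _ fun i => ?_
      by_cases h : i = e₀
      · simp only [h, dif_pos]; exact measurable_snd.comp measurable_fst
      · simp only [h, dif_neg, not_false_eq_true]; exact (measurable_pi_apply _).comp (measurable_fst.comp measurable_snd)
    · exact measurable_fst.comp (measurable_snd.comp measurable_snd)
    · refine measurable_pi_lambda _ fun y => ?_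
      by_cases h : y = y₀
      · simp only [h, dif_pos]; exact measurable_fst.comp measurable_fst
      · simp only [h, dif_neg, not_false_eq_true]
        exact (measurable_pi_apply _).comp (measurable_snd.comp (measurable_snd.comp measurable_snd))

end Summit.QuantumFields.YangMills.Theorems.VirialFluxGap.FixSplit

end
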